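import Mathlib
import Summits.MatrixMultiplication.MatrixMultiplication.Theses.SnSubsetDichotomy
import Summits.MatrixMultiplication.MatrixMultiplication.Theorems.SnSubsetDichotomyDichotomyInduction

/-!
# `SnSubsetDichotomy`: the dichotomy glue needs `JuntaBranch` only at volume MAXIMISERS ("JB_max")

Crux `stmt-MatrixMultiplication-8304` (`JuntaBranch`) is consumed by exactly one item of route
`SnSubsetDichotomy`, the glue `DichotomyInduction : GlobalBranch → JuntaBranch → NoThresholdSubsetTriple`
(item 8309, tree theorem `dichotomyInduction_proof`).  Triage r1-2 (T5) observed that the potential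
argument only ever needs the junta branch for TPP triples of MAXIMAL volume at their level: at every
stage of the descent one may first replace the current triple by a volume maximiser of the same `S_m`
(it exists by finiteness and only raises the potential), so that `GlobalBranch` (bump-free case) or
the junta branch FOR MAXIMISERS (bumpy case) applies.  This file proves that observation,
`noThreshold_of_globalBranch_of_jbMax` (registered sub-goal of the crux): `GlobalBranch` together with
"JB_max" — the crux `JuntaBranch` with the extra hypothesis that `(S,T,U)` has maximal volume among all
TPP triples of `S_n` — already implies `NoThresholdSubsetTriple`.  Hence the planner may WEAKEN the crux
to JB_max without touching the route's assembly (the lead's recommendation (b); recommendation (a),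
the loss-free restatement as the near-maximiser form, is `juntaBranch_of_nearMaxImproves`).

The proof is the tree's `dichotomyInduction_proof` verbatim (its public step lemmas
`dichotomyInduction_potential_step`, `_nobump_absurd`, `_final_absurd`, `_sqrt_sub_one_le`,
`_card_le_rpow`, `_and_or_not` are reused), with the maximiser swap `exists_maxVol_triple` inserted
before the case split.
-/

set_option linter.dupNamespace false

open Literature.Combinatorics.Additive
open Summit.MatrixMultiplication.MatrixMultiplication.Theses.SnSubsetDichotomy
open scoped Classical

namespace Summit.MatrixMultiplication.MatrixMultiplication.Theorems.JuntaBranch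

/-- **Volume maximisers exist**: among the TPP triples of `S_m` there is one of maximal volume
`|S||T||U|` (finitely many triples; `(∅, ∅, ∅)` has the property vacuously). [folklore] -/
theorem exists_maxVol_triple (m : ℕ) :
    ∃ S T U : Finset (Equiv.Perm (Fin m)), TripleProductProperty S T U ∧
      ∀ S₁ T₁ U₁ : Finset (Equiv.Perm (Fin m)), TripleProductProperty S₁ T₁ U₁ →
        S₁.card * T₁.card * U₁.card ≤ S.card * T.card * U.card := by
  set F : Finset (Finset (Equiv.Perm (Fin m)) × Finset (Equiv.Perm (Fin m)) ×
      Finset (Equiv.Perm (Fin m))) :=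
    Finset.univ.filter (fun x => TripleProductProperty x.1 x.2.1 x.2.2) with hF
  have h0 : ((∅ : Finset (Equiv.Perm (Fin m))), (∅ : Finset (Equiv.Perm (Fin m))),
      (∅ : Finset (Equiv.Perm (Fin m)))) ∈ F := by
    simp only [hF, Finset.mem_filter, Finset.mem_univ, true_and]
    intro s hs
    simp at hs
  obtain ⟨x, hx, hmax⟩ := F.exists_max_image (fun x => x.1.card * x.2.1.card * x.2.2.card) ⟨_, h0⟩
  refine ⟨x.1, x.2.1, x.2.2, (Finset.mem_filter.mp hx).2, fun S₁ T₁ U₁ h₁ => ?_⟩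
  exact hmax (S₁, T₁, U₁) (Finset.mem_filter.mpr ⟨Finset.mem_univ _, h₁⟩)

/-- **`GlobalBranch ∧ JB_max ⇒ NoThresholdSubsetTriple`** (triage r1-2 T5, registered sub-goal
`noThreshold_of_globalBranch_of_jbMax` of crux stmt-MatrixMultiplication-8304).  The second hypothesis
is the crux `JuntaBranch` VERBATIM with one extra hypothesis inserted after the volume floor: the triple
has maximal volume among all TPP triples of the same `S_n`.  Proof: the potential/descent argument of
`dichotomyInduction_proof` (`c₀ := min (c₁/2) (1/2)`, `n₀ := 2 (max n₁ n₂ + 1)`, `K := ⌊c₀√n⌋ + 1`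
steps beat the packing bound), replacing the triple at each level by a volume maximiser
(`exists_maxVol_triple`) before casing on bump-freeness. -/
theorem noThreshold_of_globalBranch_of_jbMax :
    GlobalBranch →
    (∀ ε : ℝ, 0 < ε → ∀ c : ℝ, 0 < c → ∃ n₀ : ℕ, ∀ n ≥ n₀, ∀ S T U : Finset (Equiv.Perm (Fin n)),
      TripleProductProperty S T U →
      (n.factorial : ℝ) ^ ((3 : ℝ) / 2) * Real.exp (-(c * Real.sqrt (n : ℝ))) ≤
        ((S.card * T.card * U.card : ℕ) : ℝ) →
      (∀ S₁ T₁ U₁ : Finset (Equiv.Perm (Fin n)), TripleProductProperty S₁ T₁ U₁ →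
        S₁.card * T₁.card * U₁.card ≤ S.card * T.card * U.card) →
      (∃ X : Finset (Equiv.Perm (Fin n)), (X = S ∨ X = T ∨ X = U) ∧ ∃ t : ℕ, 1 ≤ t ∧
        (t : ℝ) ≤ Real.sqrt (n : ℝ) ∧ ∃ I L : Fin t → Fin n, Function.Injective I ∧
        Function.Injective L ∧ (n : ℝ) ^ ((1 / 2 + ε) * t) * (X.card : ℝ) <
          ((X.filter (fun σ => ∀ k, σ (I k) = L k)).card : ℝ) * (n.descFactorial t : ℝ)) →
      ∃ n' : ℕ, (n : ℝ) - Real.sqrt (n : ℝ) ≤ (n' : ℝ) ∧ n' < n ∧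
        ∃ S' T' U' : Finset (Equiv.Perm (Fin n')), TripleProductProperty S' T' U' ∧
          Real.exp (c + 1) * ((S.card * T.card * U.card : ℕ) : ℝ) *
              ((n'.factorial : ℝ) / (n.factorial : ℝ)) ^ ((3 : ℝ) / 2) ≤
            ((S'.card * T'.card * U'.card : ℕ) : ℝ)) →
    NoThresholdSubsetTriple := by
  intro hGB hJB
  obtain ⟨ε, hε, c₁, hc₁, n₁, hG⟩ := hGB
  -- the constants
  set c₀ : ℝ := min (c₁ / 2) (1 / 2) with hc₀def
  have hc₀pos : 0 < c₀ := lt_min (half_pos hc₁) one_half_pos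
  have hc₀lt : c₀ < c₁ := (min_le_left _ _).trans_lt (half_lt_self hc₁)
  have hc₀half : c₀ ≤ 1 / 2 := min_le_right _ _
  obtain ⟨n₂, hJ⟩ := hJB ε hε c₀ hc₀pos
  set M : ℕ := max n₁ n₂ + 1 with hMdef
  refine ⟨c₀, hc₀pos, 2 * M, fun n hn S T U hTPP => ?_⟩
  by_contra hlt
  rw [not_le] at hlt
  have h2M : (2 * M : ℝ) ≤ n := by exact_mod_cast hn
  have hsqn : Real.sqrt n * Real.sqrt n = n := Real.mul_self_sqrt (Nat.cast_nonneg n)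
  -- the descent: `R k` for all `k ≤ c₀√n + 1`
  have hR : ∀ k : ℕ, (k : ℝ) ≤ c₀ * Real.sqrt n + 1 → ∃ m : ℕ, m ≤ n ∧
      (n : ℝ) - k * Real.sqrt n ≤ m ∧ ∃ S T U : Finset (Equiv.Perm (Fin m)),
      TripleProductProperty S T U ∧
      Real.exp k * ((m.factorial : ℝ) ^ ((3 : ℝ) / 2) * Real.exp (-(c₀ * Real.sqrt m))) ≤
        ((S.card * T.card * U.card : ℕ) : ℝ) := by
    intro k
    induction k with
    | zero =>
      intro _
      refine ⟨n, le_rfl, by simp, S, T, U, hTPP, ?_⟩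
      simpa using hlt.le
    | succ k ih =>
      intro hk
      simp only [Nat.cast_add_one] at hk ⊢
      have hk' : (k : ℝ) ≤ c₀ * Real.sqrt n := by linarith
      obtain ⟨m, hmn, hkm, S₀, T₀, U₀, hTPP₀, hP₀⟩ := ih (by linarith)
      -- swap in a volume maximiser at level `m` (it only raises the potential)
      obtain ⟨Sm, Tm, Um, hTPPm, hmaxm⟩ := exists_maxVol_triple m
      have hvol : ((S₀.card * T₀.card * U₀.card : ℕ) : ℝ) ≤ ((Sm.card * Tm.card * Um.card : ℕ) : ℝ) := by
        exact_mod_cast hmaxm S₀ T₀ U₀ hTPP₀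
      have hPm : Real.exp k * ((m.factorial : ℝ) ^ ((3 : ℝ) / 2) * Real.exp (-(c₀ * Real.sqrt m))) ≤
          ((Sm.card * Tm.card * Um.card : ℕ) : ℝ) := hP₀.trans hvol
      -- the level stays above `M`
      have hkn : (k : ℝ) * Real.sqrt n ≤ c₀ * n := by
        calc (k : ℝ) * Real.sqrt n ≤ c₀ * Real.sqrt n * Real.sqrt n :=
            mul_le_mul_of_nonneg_right hk' (Real.sqrt_nonneg _)
          _ = c₀ * n := by rw [mul_assoc, hsqn]
      have hc₀n : c₀ * n ≤ 1 / 2 * n := mul_le_mul_of_nonneg_right hc₀half (Nat.cast_nonneg n)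
      have hMm : M ≤ m := by
        have h : (M : ℝ) ≤ m := by linarith
        exact_mod_cast h
      have hmax : max n₁ n₂ ≤ m := Nat.le_of_succ_le hMm
      have hm₁ : n₁ ≤ m := le_of_max_le_left hmax
      have hm₂ : n₂ ≤ m := le_of_max_le_right hmax
      have hm1 : 1 ≤ m := le_trans (Nat.le_add_left 1 _) hMm
      have hfm : (0 : ℝ) < m.factorial := by exact_mod_cast m.factorial_pos
      have hsm : 0 < Real.sqrt m := Real.sqrt_pos.2 (by exact_mod_cast hm1)
      -- threshold at level `m`
      have hthr : (m.factorial : ℝ) ^ ((3 : ℝ) / 2) * Real.exp (-(c₀ * Real.sqrt m)) ≤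
          ((Sm.card * Tm.card * Um.card : ℕ) : ℝ) :=
        le_trans (le_mul_of_one_le_left (by positivity) (Real.one_le_exp (Nat.cast_nonneg k))) hPm
      rcases dichotomyInduction_and_or_not (hG m hm₁ Sm Tm Um hTPPm) with ⟨-, hbound⟩ | hnb
      · -- bump-free: contradicts `GlobalBranch`
        exact (dichotomyInduction_nobump_absurd hfm (Nat.cast_nonneg k) hc₀lt hsm hPm hbound).elim
      · -- a super-neutral bump in a MAXIMISER: JB_max descends
        push Not at hnb
        obtain ⟨m', hm'ge, hm'lt, S', T', U', hTPP', hP'⟩ :=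
          hJ m hm₂ Sm Tm Um hTPPm hthr hmaxm hnb
        refine ⟨m', hm'lt.le.trans hmn, ?_, S', T', U', hTPP', ?_⟩
        · have hsmn : Real.sqrt m ≤ Real.sqrt n := Real.sqrt_le_sqrt (by exact_mod_cast hmn)
          linarith
        · exact dichotomyInduction_potential_step hc₀pos hfm (Nat.cast_nonneg _)
            (by linarith [dichotomyInduction_sqrt_sub_one_le (Nat.cast_nonneg m) hm'ge]) hPm hP'
  -- the end of the descent: `K := ⌊c₀√n⌋ + 1` steps beat the packing bound
  have hc₀s : 0 ≤ c₀ * Real.sqrt n := mul_nonneg hc₀pos.le (Real.sqrt_nonneg _)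
  obtain ⟨m, hmn, -, Sm, Tm, Um, hTPPm, hPm⟩ := hR (⌊c₀ * Real.sqrt n⌋₊ + 1)
    (by push_cast; linarith [Nat.floor_le hc₀s])
  have hfm : (0 : ℝ) < m.factorial := by exact_mod_cast m.factorial_pos
  have hsmn : Real.sqrt m ≤ Real.sqrt n := Real.sqrt_le_sqrt (by exact_mod_cast hmn)
  exact dichotomyInduction_final_absurd hfm (K := ((⌊c₀ * Real.sqrt n⌋₊ + 1 : ℕ) : ℝ))
    (by push_cast; exact Nat.lt_floor_add_one _) (mul_le_mul_of_nonneg_left hsmn hc₀pos.le) hPm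
    (dichotomyInduction_card_le_rpow hTPPm)

end Summit.MatrixMultiplication.MatrixMultiplication.Theorems.JuntaBranch
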